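/-
Copyright (c) 2026 the pub-hodgecm-mathlib formalisation cell (harness21).  Prover seat hodgecm-mathlib-K2E3-p21 (g6), Track B «K2-LIT» ∕ h413
(`stmt-HodgeConjecture-24833`), line `K2_E3_EllipticInputs`, road «GL₂-sc» (road owner K2E5-p17 (g5), ASSIGNMENTS 2026-09-04T09:19:45Z; dealer K2E3-plan (g4) D66;
BRICK LIST v1.1), brick (2A-1) = the `N = 2` twin of ★ (B6-core) `K2E3GL3ModCocompactCharLocInt` (K2E3-p23 (g5)), HYPOTHESIS-FIRST on (FC) (head of (2E-b2)) and on the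
NON-ELLIPTIC estimates (NE half 2N, K2E3-p23 (g6)).  2026-09-04.
-/
import Summits.HodgeConjecture.HodgeConjecture.Theorems.K2E3GL2ModCocompactEllPackage             -- (2E-c) (this seat): `exists_ellWeight_quotScalar_of_finConj_cc`; brings ★ 2E-b2 `finConjModCocompact_cc`, ★ 2F-a ∕ 2F-b ∕ 2F-b′
import Summits.HodgeConjecture.HodgeConjecture.Theorems.K2E3GL2ModCocompactFrame                  -- ★ (2F-b″) (K2E5-p17 (g5)): `nonarchimedeanGroup_quotScalar`, `isCompact_center_quotScalar`, `isInvInvariant_quotScalar_of_isHaarMeasure`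
import Summits.HodgeConjecture.HodgeConjecture.Theorems.K2E3GL2FinConj                           -- ★ (2E-a5) p858976 (K2E3-p17 (g8)): `finConjGL_cc` — (FC) on `Ḡ = GL₂(F) ⧸ Z`, UNCONDITIONAL (ED. 2)
import Summits.HodgeConjecture.HodgeConjecture.Theorems.K2E3SupercuspidalCharacterDominatedLimit  -- ★ p856074 (K2E3-p20): HC 1970 Thm 16 assembly (generic `G`)
import Summits.HodgeConjecture.HodgeConjecture.Theorems.F0P3bSupercuspidalUnitarizable            -- ★ `Representation.isUnitarizable_of_isSupercuspidal_of_isCompact_center`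
import Literature.NumberTheory.Automorphic.MatrixCoefficientsSupercuspidalAdmissibleProofs        -- ★ `Representation.IsSupercuspidal.isAdmissible_of_sigmaCompactSpace`
import Literature.NumberTheory.Automorphic.AdmissibleInvariantFormSchur                           -- ★ `IsSupercuspidal.hasCompactSupport_sesqForm_apply_apply`, `continuous_sesqForm_apply_apply`
import HarnessLib

/-!
# Crux `H413` — K2-LIT E3, road «GL₂-sc», brick (2A-1): Harish-Chandra's Theorem 16 on `G_Λ = GL₂(F) ⧸ Λ·1` — the character of a supercuspidal class is an
# `L¹_loc` FUNCTION, modulo (FC) and the NON-ELLIPTIC estimates (the `N = 2` twin of ★ B6-core `K2E3GL3ModCocompactCharLocInt`, K2E3-p23 (g5))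

Cell `hodgecm-mathlib`, Track B, line `K2_E3_EllipticInputs`, road «GL₂-sc» = Harish-Chandra's local integrability for supercuspidal `GL₂(F)` (letter (S-C′-GL₂sc) of the
hosted leaf (nsc-S-C′); road owner K2E5-p17 (g5); BRICK LIST v1.1 `K2/K2E5-p17/g5/BRICKLIST-GL2sc-v1.1.K2E5-p17-g5.md`).  The composition at `G_Λ` of ★ p856074
(Harish-Chandra 1970 Thm 16, generic) with the ELLIPTIC package (2E-c): for a supercuspidal class `c` of `G_Λ` with representative `r`, invariant positive-definite
Hermitian `B`, `v₁ ≠ 0`, a compact exhaustion `Ω` and the truncated orbital integrals `Θₙ(g) := ∫_{Ω n} B v₁ (r(xgx⁻¹) v₁) dμ` of the coefficient, IF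

  **(FC)** `∫⁻_{C ∩ {Z compact}} ∫⁻ β(xgx⁻¹) dμ dμ < ⊤` for every compact `C` and every compactly supported bounded `β ≥ 0` (hypothesis `hFC` — the head of (2E-b2)
  `K2E3GL2FinConjModCocompact`, K2E3-p11 (g6)),
  **(lim∖ell)** `Θₙ(g) → F(g)` for a.e. `g` with NON-compact centraliser, and
  **(dom∖ell)** `‖Θₙ(g)‖ ≤ M(g)` for a.e. `g` with NON-compact centraliser, all `n`, with `M ∈ L¹_loc(μ)` (the NE half 2N, K2E3-p23 (g6)),

THEN `∃ Θ ∈ L¹_loc(μ)` with `χ_c(f) = ∫ f Θ dμ` for EVERY test function `f` (global form), hence the row-11 shape «charLocIntNear s» at EVERY `s ∈ G_Λ`.  The elliptic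
half of (lim)/(dom) is DISCHARGED by (2E-c) `exists_ellWeight_quotScalar_of_finConj_cc` (a.e. form: no Lemma 14, no regularity).  The frame inputs of ★ p856074 —
`[NonarchimedeanGroup G_Λ]`, `hZ : IsCompact (center G_Λ)`, `[μ.IsInvInvariant]` — enter as hypotheses in §2 (token for token as in ★ B6-core) and are DISCHARGED in §3
by ★ (2F-b″) `K2E3GL2ModCocompactFrame`.

* §1 `exists_rep_data_of_isSupercuspidal_quotScalar` — class plumbing: a supercuspidal class of `G_Λ` has an admissible supercuspidal representative with an invariant
  positive-definite Hermitian form (★ `isUnitarizable_of_isSupercuspidal_of_isCompact_center`, compact open `K_Λ` ★ (2F-b′), compact centre).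
* §2 **`exists_locallyIntegrable_smoothTrace_eq_quotScalar`** (global), **`charLocIntNear_quotScalar_of_nonell`** (row-11 shape at every `s`),
  **`charLocIntNear_quotScalar_of_exists_nonell`** (∃-packaged) — ★ B6-core with `Fin 3 ↦ Fin 2` and the extra binder `hFC`.
* §3 **`charLocIntNear_quotScalar_of_finConjGL_cc_of_nonell`** — §2 with the frame discharged (★ 2F-b″), (FC) at `G_Λ` discharged by ★ (2E-b2) from Harish-Chandra's
  finiteness `hcc` on `Ḡ = GL₂(F) ⧸ Z` (the head of ★ (2E-b1) ∘ (2E-a5), ★ (2E-b2)'s binder verbatim), and the datum chosen by §1: inputs = `hcc` + the non-elliptic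
  estimates `hNE` for every unitarizable supercuspidal datum (the BRICK LIST v1.1 §1 `hNE₂` binder shape at this `μ`).
* §4 (ED. 2) **`charLocIntNear_quotScalar_of_nonell_estimates`** — §3 with `hcc` DISCHARGED by ★ (2E-a5) `K2E3GL2FinConj.finConjGL_cc` (unconditional (FC) on `Ḡ`): the
  only remaining input is `hNE` (the NE half 2N).

HONEST LABEL: HC_CM is proved only modulo the 7 printed citations (2 remaining named inputs: hLiu418 = stmt-HodgeConjecture-24832, h413 =
stmt-HodgeConjecture-24833) until rung 0 closes; count-neutral (kernel lane `--supports stmt-HodgeConjecture-24833 --as helper`), THEOREMS ONLY; CONDITIONAL on (FC)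
(brick 2E-b2, in flight) and on the non-elliptic estimates (NE half 2N, in flight) — it closes nothing by itself.

References: Harish-Chandra (van Dijk) 1970, Part VII Thm 16 p. 67, §3 pp. 70–73 [cite: HarishChandra1970, Part VII Thm 16 p. 67]; Rogawski 1990 §1.6 pp. 5–6, §12.2
p. 173 [cite: Rogawski1990, §12.2 p. 173]; Bernstein–Zelevinsky 1976 §2.40–2.42 [cite: BernsteinZelevinsky1976, §2.40–2.42].
-/

open MeasureTheory MeasureTheory.Measure Set Function Filter
open scoped NNReal ENNReal MatrixGroups Pointwise WithZero Valued Topology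
open Matrix
open Literature.NumberTheory.Automorphic Literature.NumberTheory.GaloisRepresentations Literature.NumberTheory.GaloisRepresentations.IsNonarchimedeanLocalField
open Summit.HodgeConjecture.HodgeConjecture.Cruxes.H413.K2E3GL2ModCentre Summit.HodgeConjecture.HodgeConjecture.Cruxes.H413.K2E3GL2ModCocompactCentral
open Summit.HodgeConjecture.HodgeConjecture.Cruxes.H413.K2E3GL2ModCocompactUnimodular Summit.HodgeConjecture.HodgeConjecture.Cruxes.H413.K2E3GL2ModCocompactEllPackage
open Summit.HodgeConjecture.HodgeConjecture.Cruxes.H413.K2E3GL2ModCocompactFrame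
open Summit.HodgeConjecture.HodgeConjecture.Cruxes.H413.K2E3GL2FinConjModCocompact (finConjModCocompact_cc)

set_option linter.dupNamespace false

noncomputable section

namespace Summit.HodgeConjecture.HodgeConjecture.Cruxes.H413.K2E3GL2ModCocompactCharLocInt

variable {F : Type*} [Field F] [Valued F ℤᵐ⁰] [ValuativeRel F] [(Valued.v : Valuation F ℤᵐ⁰).Compatible] [IsNonarchimedeanLocalField F]
  (Λ₀ : Subgroup Fˣ) [(Λ₀.map (Matrix.GeneralLinearGroup.scalar (Fin 2))).Normal]

/-! ## §1 Class plumbing at `G_Λ` -/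

omit [(Valued.v : Valuation F ℤᵐ⁰).Compatible] in
/-- **A supercuspidal class of `G_Λ` (compact centre) has an ADMISSIBLE supercuspidal representative with a `G_Λ`-invariant positive-definite Hermitian form**
(★ `IsSupercuspidal.isAdmissible_of_sigmaCompactSpace`; ★ `isUnitarizable_of_isSupercuspidal_of_isCompact_center` with the compact open `K_Λ` ★ (2F-b′)).
[cite: BernsteinZelevinsky1976, §2.40–2.42] [cite: Rogawski1990, §12.2 p. 173] -/
theorem exists_rep_data_of_isSupercuspidal_quotScalar [NonarchimedeanGroup (GL (Fin 2) F ⧸ Λ₀.map (Matrix.GeneralLinearGroup.scalar (Fin 2)))]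
    (hZ : IsCompact ((Subgroup.center (GL (Fin 2) F ⧸ Λ₀.map (Matrix.GeneralLinearGroup.scalar (Fin 2)))) :
      Set (GL (Fin 2) F ⧸ Λ₀.map (Matrix.GeneralLinearGroup.scalar (Fin 2)))))
    (c : IrrClass (GL (Fin 2) F ⧸ Λ₀.map (Matrix.GeneralLinearGroup.scalar (Fin 2)))) (hc : c.IsSupercuspidal) :
    ∃ r : SmoothIrrep (GL (Fin 2) F ⧸ Λ₀.map (Matrix.GeneralLinearGroup.scalar (Fin 2))), IrrClass.mk r = c ∧ r.ρ.IsSupercuspidal ∧ r.ρ.IsAdmissible ∧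
      ∃ B : r.V →ₗ⋆[ℂ] r.V →ₗ[ℂ] ℂ, B.IsSymm ∧ (∀ x : r.V, x ≠ 0 → 0 < (B x x).re) ∧
        ∀ (g : GL (Fin 2) F ⧸ Λ₀.map (Matrix.GeneralLinearGroup.scalar (Fin 2))) (x y : r.V), B (r.ρ g x) (r.ρ g y) = B x y := by
  haveI : SecondCountableTopology (GL (Fin 2) F) := secondCountableTopology_gl2 F
  haveI : LocallyCompactSpace (GL (Fin 2) F) := locallyCompactSpace_gl2 F
  haveI : SigmaCompactSpace (GL (Fin 2) F ⧸ Λ₀.map (Matrix.GeneralLinearGroup.scalar (Fin 2))) := sigmaCompactSpace_of_locallyCompact_secondCountable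
  induction c using IrrClass.ind with
  | h r =>
    rw [IrrClass.isSupercuspidal_mk] at hc
    haveI : r.ρ.IsIrreducible := r.isIrreducible
    have hadm : r.ρ.IsAdmissible := Representation.IsSupercuspidal.isAdmissible_of_sigmaCompactSpace r.isSmooth hc
    obtain ⟨B, hBsymm, hBpos, hBinv⟩ :=
      r.ρ.isUnitarizable_of_isSupercuspidal_of_isCompact_center r.isSmooth (isOpen_kLambda Λ₀) (isCompact_kLambda Λ₀) hc hZ
    exact ⟨r, rfl, hc, hadm, B, hBsymm, hBpos, hBinv⟩

/-! ## §2 The composition: (lim∖ell) ⊕ (dom∖ell) ⇒ the character of a supercuspidal class of `G_Λ` is an `L¹_loc` function -/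

variable [MeasurableSpace (GL (Fin 2) F ⧸ Λ₀.map (Matrix.GeneralLinearGroup.scalar (Fin 2)))] [BorelSpace (GL (Fin 2) F ⧸ Λ₀.map (Matrix.GeneralLinearGroup.scalar (Fin 2)))]

open scoped Classical in
/-- **(road «GL₂-sc», 2A-1 = B6-core at `N = 2`) HARISH-CHANDRA'S THEOREM 16 ON `G_Λ = GL₂(F) ⧸ Λ·1`, MODULO (FC) AND THE NON-ELLIPTIC ESTIMATES.**  (FC) over the
compact-centraliser domain enters as the hypothesis `hFC` (the head of (2E-b2) at this `μ`; it feeds ★ (2E-c)).   `Λ ≤ F^×` closed, `F^× ⧸ Λ` compact, `μ` an inversion-invariant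
Haar measure on `G_Λ` (nonarchimedean, compact centre — brick B2); `c` a class with supercuspidal representative `r`, invariant positive-definite Hermitian `B`, `v₁ ≠ 0`,
`Ω` a compact exhaustion.  IF the truncated orbital integrals of the coefficient CONVERGE (`hlim`) and are DOMINATED by `M ∈ L¹_loc` (`hdom`, `hM`) almost everywhere
OFF the compact-centraliser set, THEN `∃ Θ ∈ L¹_loc(μ)`, `χ_c(f) = ∫ f Θ dμ` for every `f ∈ C_c^∞(G_Λ)`.  The elliptic halves of `hlim`/`hdom` are ★ (2E-c)
(`exists_ellWeight_quotScalar_of_finConj_cc`, from `hFC`: the orbital integrals are eventually constant and bounded by the `L¹_loc` weight `W_E` a.e. ON the compact-centraliser set); the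
majorant is `‖M‖ + W_E`; then ★ p856074 `locallyIntegrable_of_truncatedOrbital_tendsto` ∕ `smoothTrace_eq_integral_mul_of_truncatedOrbital_tendsto`.
[cite: HarishChandra1970, Part VII Thm 16 p. 67] [cite: Rogawski1990, §12.2 p. 173] -/
theorem exists_locallyIntegrable_smoothTrace_eq_quotScalar {ϖ : F} (hϖ : Valued.v ϖ = WithZero.exp (-1 : ℤ)) (hΛ : IsClosed (Λ₀ : Set Fˣ))
    [NonarchimedeanGroup (GL (Fin 2) F ⧸ Λ₀.map (Matrix.GeneralLinearGroup.scalar (Fin 2)))]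
    (μ : Measure (GL (Fin 2) F ⧸ Λ₀.map (Matrix.GeneralLinearGroup.scalar (Fin 2)))) [μ.IsHaarMeasure] [μ.IsInvInvariant]
    (hFC : ∀ {C : Set (GL (Fin 2) F ⧸ Λ₀.map (Matrix.GeneralLinearGroup.scalar (Fin 2)))}, IsCompact C →
      ∀ {β : (GL (Fin 2) F ⧸ Λ₀.map (Matrix.GeneralLinearGroup.scalar (Fin 2))) → ℝ≥0∞}, IsCompact (tsupport β) →
      ∀ {Mb : ℝ≥0∞}, Mb ≠ ⊤ → (∀ g, β g ≤ Mb) →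
        ∫⁻ g in C ∩ {h : GL (Fin 2) F ⧸ Λ₀.map (Matrix.GeneralLinearGroup.scalar (Fin 2)) |
            IsCompact ((Subgroup.centralizer ({h} : Set (GL (Fin 2) F ⧸ Λ₀.map (Matrix.GeneralLinearGroup.scalar (Fin 2))))) :
              Set (GL (Fin 2) F ⧸ Λ₀.map (Matrix.GeneralLinearGroup.scalar (Fin 2))))},
          ∫⁻ x, β (x * g * x⁻¹) ∂μ ∂μ < ⊤)
    (hZ : IsCompact ((Subgroup.center (GL (Fin 2) F ⧸ Λ₀.map (Matrix.GeneralLinearGroup.scalar (Fin 2)))) :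
      Set (GL (Fin 2) F ⧸ Λ₀.map (Matrix.GeneralLinearGroup.scalar (Fin 2)))))
    (c : IrrClass (GL (Fin 2) F ⧸ Λ₀.map (Matrix.GeneralLinearGroup.scalar (Fin 2))))
    (r : SmoothIrrep (GL (Fin 2) F ⧸ Λ₀.map (Matrix.GeneralLinearGroup.scalar (Fin 2)))) (hr : IrrClass.mk r = c) (hsc : r.ρ.IsSupercuspidal)
    (B : r.V →ₗ⋆[ℂ] r.V →ₗ[ℂ] ℂ) (hBsymm : B.IsSymm) (hBpos : ∀ x : r.V, x ≠ 0 → 0 < (B x x).re)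
    (hBinv : ∀ (g : GL (Fin 2) F ⧸ Λ₀.map (Matrix.GeneralLinearGroup.scalar (Fin 2))) (x y : r.V), B (r.ρ g x) (r.ρ g y) = B x y)
    (v₁ : r.V) (hv₁ : v₁ ≠ 0)
    (Ω : CompactExhaustion (GL (Fin 2) F ⧸ Λ₀.map (Matrix.GeneralLinearGroup.scalar (Fin 2))))
    (Fl : (GL (Fin 2) F ⧸ Λ₀.map (Matrix.GeneralLinearGroup.scalar (Fin 2))) → ℂ) (M : (GL (Fin 2) F ⧸ Λ₀.map (Matrix.GeneralLinearGroup.scalar (Fin 2))) → ℝ)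
    (hlim : ∀ᵐ g ∂μ, ¬ IsCompact ((Subgroup.centralizer ({g} : Set (GL (Fin 2) F ⧸ Λ₀.map (Matrix.GeneralLinearGroup.scalar (Fin 2))))) :
        Set (GL (Fin 2) F ⧸ Λ₀.map (Matrix.GeneralLinearGroup.scalar (Fin 2)))) →
      Tendsto (fun n => ∫ x in Ω n, B v₁ (r.ρ (x * g * x⁻¹) v₁) ∂μ) atTop (𝓝 (Fl g)))
    (hdom : ∀ n, ∀ᵐ g ∂μ, ¬ IsCompact ((Subgroup.centralizer ({g} : Set (GL (Fin 2) F ⧸ Λ₀.map (Matrix.GeneralLinearGroup.scalar (Fin 2))))) :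
        Set (GL (Fin 2) F ⧸ Λ₀.map (Matrix.GeneralLinearGroup.scalar (Fin 2)))) →
      ‖∫ x in Ω n, B v₁ (r.ρ (x * g * x⁻¹) v₁) ∂μ‖ ≤ M g)
    (hM : LocallyIntegrable M μ) :
    ∃ Θ : (GL (Fin 2) F ⧸ Λ₀.map (Matrix.GeneralLinearGroup.scalar (Fin 2))) → ℂ, LocallyIntegrable Θ μ ∧
      ∀ f : (GL (Fin 2) F ⧸ Λ₀.map (Matrix.GeneralLinearGroup.scalar (Fin 2))) → ℂ,
        f ∈ SchwartzBruhat (GL (Fin 2) F ⧸ Λ₀.map (Matrix.GeneralLinearGroup.scalar (Fin 2))) → c.smoothTrace μ f = ∫ g, f g * Θ g ∂μ := by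
  subst hr
  -- §0 frame
  haveI : SecondCountableTopology (GL (Fin 2) F) := secondCountableTopology_gl2 F
  haveI : LocallyCompactSpace (GL (Fin 2) F) := locallyCompactSpace_gl2 F
  haveI : T2Space (GL (Fin 2) F ⧸ Λ₀.map (Matrix.GeneralLinearGroup.scalar (Fin 2))) := t2Space_quotScalar Λ₀ hΛ
  haveI : SigmaCompactSpace (GL (Fin 2) F ⧸ Λ₀.map (Matrix.GeneralLinearGroup.scalar (Fin 2))) := sigmaCompactSpace_of_locallyCompact_secondCountable
  haveI : r.ρ.IsIrreducible := r.isIrreducible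
  have hadm : r.ρ.IsAdmissible := Representation.IsSupercuspidal.isAdmissible_of_sigmaCompactSpace r.isSmooth hsc
  have hΩm : ∀ n, MeasurableSet (Ω n) := fun n => (Ω.isCompact n).isClosed.measurableSet
  have hΩc : ∀ n, IsCompact (Ω n) := fun n => Ω.isCompact n
  have hΩmono : Monotone Ω := fun m n hmn => Ω.subset hmn
  have hΩcov : ∀ x, ∃ n, x ∈ Ω n := fun x => Ω.exists_mem x
  -- §1 the coefficient and its elliptic package (2E-c)
  have hθc : Continuous fun y : GL (Fin 2) F ⧸ Λ₀.map (Matrix.GeneralLinearGroup.scalar (Fin 2)) => B v₁ (r.ρ y v₁) :=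
    Representation.continuous_sesqForm_apply_apply (r.isSmooth v₁) v₁
  have hθs : HasCompactSupport fun y : GL (Fin 2) F ⧸ Λ₀.map (Matrix.GeneralLinearGroup.scalar (Fin 2)) => B v₁ (r.ρ y v₁) :=
    hsc.hasCompactSupport_sesqForm_apply_apply hZ r.isSmooth hBinv v₁ v₁
  obtain ⟨W, hWloc, hW0, hae⟩ := exists_ellWeight_quotScalar_of_finConj_cc hϖ Λ₀ hΛ μ hFC hθc hθs Ω
  -- §2 the limit redefined on the compact-centraliser set; the majorant `‖M‖ + W`
  set F' : (GL (Fin 2) F ⧸ Λ₀.map (Matrix.GeneralLinearGroup.scalar (Fin 2))) → ℂ := fun g =>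
    if IsCompact ((Subgroup.centralizer ({g} : Set (GL (Fin 2) F ⧸ Λ₀.map (Matrix.GeneralLinearGroup.scalar (Fin 2))))) :
        Set (GL (Fin 2) F ⧸ Λ₀.map (Matrix.GeneralLinearGroup.scalar (Fin 2))))
      then ∫ x, B v₁ (r.ρ (x * g * x⁻¹) v₁) ∂μ else Fl g with hF'
  have hlim' : ∀ᵐ g ∂μ, Tendsto (fun n => ∫ x in Ω n, B v₁ (r.ρ (x * g * x⁻¹) v₁) ∂μ) atTop (𝓝 (F' g)) := by
    filter_upwards [hlim, hae] with g hg hge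
    by_cases hE : IsCompact ((Subgroup.centralizer ({g} : Set (GL (Fin 2) F ⧸ Λ₀.map (Matrix.GeneralLinearGroup.scalar (Fin 2))))) :
        Set (GL (Fin 2) F ⧸ Λ₀.map (Matrix.GeneralLinearGroup.scalar (Fin 2))))
    · obtain ⟨-, R, -, -, hT, hfull, -⟩ := hge hE
      have hval : F' g = ∫ x, B v₁ (r.ρ (x * g * x⁻¹) v₁) ∂μ := by rw [hF']; exact if_pos hE
      rw [hval, ← hfull]
      exact hT
    · have hval : F' g = Fl g := by rw [hF']; exact if_neg hE
      rw [hval]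
      exact hg hE
  have hdom' : ∀ n, ∀ᵐ g ∂μ, ‖∫ x in Ω n, B v₁ (r.ρ (x * g * x⁻¹) v₁) ∂μ‖ ≤ ‖M g‖ + W g := by
    intro n
    filter_upwards [hdom n, hae] with g hg hge
    by_cases hE : IsCompact ((Subgroup.centralizer ({g} : Set (GL (Fin 2) F ⧸ Λ₀.map (Matrix.GeneralLinearGroup.scalar (Fin 2))))) :
        Set (GL (Fin 2) F ⧸ Λ₀.map (Matrix.GeneralLinearGroup.scalar (Fin 2))))
    · obtain ⟨-, R, -, hloc, -, -, hball⟩ := hge hE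
      have hint : IntegrableOn (fun x : GL (Fin 2) F ⧸ Λ₀.map (Matrix.GeneralLinearGroup.scalar (Fin 2)) => ‖B v₁ (r.ρ (x * g * x⁻¹) v₁)‖) (Ω R) μ :=
        ((hθc.comp ((continuous_id.mul continuous_const).mul continuous_id.inv)).norm.continuousOn).integrableOn_compact (Ω.isCompact R)
      calc ‖∫ x in Ω n, B v₁ (r.ρ (x * g * x⁻¹) v₁) ∂μ‖ = ‖∫ x in Ω n ∩ Ω R, B v₁ (r.ρ (x * g * x⁻¹) v₁) ∂μ‖ := by rw [hloc n]
        _ ≤ ∫ x in Ω n ∩ Ω R, ‖B v₁ (r.ρ (x * g * x⁻¹) v₁)‖ ∂μ := norm_integral_le_integral_norm _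
        _ ≤ ∫ x in Ω R, ‖B v₁ (r.ρ (x * g * x⁻¹) v₁)‖ ∂μ :=
          setIntegral_mono_set hint (Eventually.of_forall fun _ => norm_nonneg _) (Eventually.of_forall Set.inter_subset_right)
        _ ≤ W g := hball
        _ ≤ ‖M g‖ + W g := le_add_of_nonneg_left (norm_nonneg _)
    · exact (hg hE).trans ((Real.le_norm_self _).trans (le_add_of_nonneg_right (hW0 g)))
  have hM' : LocallyIntegrable (fun g => ‖M g‖ + W g) μ := by
    rw [locallyIntegrable_iff] at hM hWloc ⊢
    exact fun K hK => (hM K hK).norm.add (hWloc K hK)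
  -- §3 ★ p856074
  have hF'loc : LocallyIntegrable F' μ :=
    K2E3SupercuspidalCharacterDominatedLimit.locallyIntegrable_of_truncatedOrbital_tendsto (B := B) r.isSmooth μ v₁ Ω hΩm hlim' hdom' hM'
  have hΘloc : LocallyIntegrable (fun g => ((((∫ x, ‖B (r.ρ x v₁) v₁‖ ^ 2 ∂μ) / (B v₁ v₁).re ^ 2 : ℝ) : ℂ) * B v₁ v₁)⁻¹ * F' g) μ := by
    have h := hF'loc.smul ((((∫ x, ‖B (r.ρ x v₁) v₁‖ ^ 2 ∂μ) / (B v₁ v₁).re ^ 2 : ℝ) : ℂ) * B v₁ v₁)⁻¹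
    simpa only [Pi.smul_def, smul_eq_mul] using h
  refine ⟨fun g => ((((∫ x, ‖B (r.ρ x v₁) v₁‖ ^ 2 ∂μ) / (B v₁ v₁).re ^ 2 : ℝ) : ℂ) * B v₁ v₁)⁻¹ * F' g, hΘloc, fun f hf => ?_⟩
  rw [IrrClass.smoothTrace_mk]
  exact K2E3SupercuspidalCharacterDominatedLimit.smoothTrace_eq_integral_mul_of_truncatedOrbital_tendsto hadm hsc hZ hBsymm hBpos hBinv μ hv₁ hv₁
    Ω hΩm hΩc hΩmono hΩcov hlim' hdom' hM' hf

/-- **2A-1 in the ROW-11 SHAPE at every `s ∈ G_Λ`**: under the hypotheses of `exists_locallyIntegrable_smoothTrace_eq_quotScalar`, for every `s` there is an open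
`U ∋ s`, `Θ` integrable on `U`, with `χ_c(f) = ∫ f Θ dμ` for every test function supported in `U` (`U` = interior of a compact neighbourhood, `Θ` the global
`L¹_loc` density). [cite: HarishChandra1970, Part VII Thm 16 p. 67] [cite: HarishChandra1999, Thm. 16.1 p. 77] -/
theorem charLocIntNear_quotScalar_of_nonell {ϖ : F} (hϖ : Valued.v ϖ = WithZero.exp (-1 : ℤ)) (hΛ : IsClosed (Λ₀ : Set Fˣ))
    [NonarchimedeanGroup (GL (Fin 2) F ⧸ Λ₀.map (Matrix.GeneralLinearGroup.scalar (Fin 2)))]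
    (μ : Measure (GL (Fin 2) F ⧸ Λ₀.map (Matrix.GeneralLinearGroup.scalar (Fin 2)))) [μ.IsHaarMeasure] [μ.IsInvInvariant]
    (hFC : ∀ {C : Set (GL (Fin 2) F ⧸ Λ₀.map (Matrix.GeneralLinearGroup.scalar (Fin 2)))}, IsCompact C →
      ∀ {β : (GL (Fin 2) F ⧸ Λ₀.map (Matrix.GeneralLinearGroup.scalar (Fin 2))) → ℝ≥0∞}, IsCompact (tsupport β) →
      ∀ {Mb : ℝ≥0∞}, Mb ≠ ⊤ → (∀ g, β g ≤ Mb) →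
        ∫⁻ g in C ∩ {h : GL (Fin 2) F ⧸ Λ₀.map (Matrix.GeneralLinearGroup.scalar (Fin 2)) |
            IsCompact ((Subgroup.centralizer ({h} : Set (GL (Fin 2) F ⧸ Λ₀.map (Matrix.GeneralLinearGroup.scalar (Fin 2))))) :
              Set (GL (Fin 2) F ⧸ Λ₀.map (Matrix.GeneralLinearGroup.scalar (Fin 2))))},
          ∫⁻ x, β (x * g * x⁻¹) ∂μ ∂μ < ⊤)
    (hZ : IsCompact ((Subgroup.center (GL (Fin 2) F ⧸ Λ₀.map (Matrix.GeneralLinearGroup.scalar (Fin 2)))) :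
      Set (GL (Fin 2) F ⧸ Λ₀.map (Matrix.GeneralLinearGroup.scalar (Fin 2)))))
    (c : IrrClass (GL (Fin 2) F ⧸ Λ₀.map (Matrix.GeneralLinearGroup.scalar (Fin 2))))
    (r : SmoothIrrep (GL (Fin 2) F ⧸ Λ₀.map (Matrix.GeneralLinearGroup.scalar (Fin 2)))) (hr : IrrClass.mk r = c) (hsc : r.ρ.IsSupercuspidal)
    (B : r.V →ₗ⋆[ℂ] r.V →ₗ[ℂ] ℂ) (hBsymm : B.IsSymm) (hBpos : ∀ x : r.V, x ≠ 0 → 0 < (B x x).re)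
    (hBinv : ∀ (g : GL (Fin 2) F ⧸ Λ₀.map (Matrix.GeneralLinearGroup.scalar (Fin 2))) (x y : r.V), B (r.ρ g x) (r.ρ g y) = B x y)
    (v₁ : r.V) (hv₁ : v₁ ≠ 0)
    (Ω : CompactExhaustion (GL (Fin 2) F ⧸ Λ₀.map (Matrix.GeneralLinearGroup.scalar (Fin 2))))
    (Fl : (GL (Fin 2) F ⧸ Λ₀.map (Matrix.GeneralLinearGroup.scalar (Fin 2))) → ℂ) (M : (GL (Fin 2) F ⧸ Λ₀.map (Matrix.GeneralLinearGroup.scalar (Fin 2))) → ℝ)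
    (hlim : ∀ᵐ g ∂μ, ¬ IsCompact ((Subgroup.centralizer ({g} : Set (GL (Fin 2) F ⧸ Λ₀.map (Matrix.GeneralLinearGroup.scalar (Fin 2))))) :
        Set (GL (Fin 2) F ⧸ Λ₀.map (Matrix.GeneralLinearGroup.scalar (Fin 2)))) →
      Tendsto (fun n => ∫ x in Ω n, B v₁ (r.ρ (x * g * x⁻¹) v₁) ∂μ) atTop (𝓝 (Fl g)))
    (hdom : ∀ n, ∀ᵐ g ∂μ, ¬ IsCompact ((Subgroup.centralizer ({g} : Set (GL (Fin 2) F ⧸ Λ₀.map (Matrix.GeneralLinearGroup.scalar (Fin 2))))) :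
        Set (GL (Fin 2) F ⧸ Λ₀.map (Matrix.GeneralLinearGroup.scalar (Fin 2)))) →
      ‖∫ x in Ω n, B v₁ (r.ρ (x * g * x⁻¹) v₁) ∂μ‖ ≤ M g)
    (hM : LocallyIntegrable M μ) :
    ∀ s : GL (Fin 2) F ⧸ Λ₀.map (Matrix.GeneralLinearGroup.scalar (Fin 2)),
      ∃ U : Set (GL (Fin 2) F ⧸ Λ₀.map (Matrix.GeneralLinearGroup.scalar (Fin 2))), IsOpen U ∧ s ∈ U ∧
        ∃ Θ : (GL (Fin 2) F ⧸ Λ₀.map (Matrix.GeneralLinearGroup.scalar (Fin 2))) → ℂ, IntegrableOn Θ U μ ∧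
          ∀ f : (GL (Fin 2) F ⧸ Λ₀.map (Matrix.GeneralLinearGroup.scalar (Fin 2))) → ℂ,
            f ∈ SchwartzBruhat (GL (Fin 2) F ⧸ Λ₀.map (Matrix.GeneralLinearGroup.scalar (Fin 2))) → tsupport f ⊆ U →
              c.smoothTrace μ f = ∫ g, f g * Θ g ∂μ := by
  haveI : SecondCountableTopology (GL (Fin 2) F) := secondCountableTopology_gl2 F
  haveI : LocallyCompactSpace (GL (Fin 2) F) := locallyCompactSpace_gl2 F
  intro s
  obtain ⟨Θ, hΘ, htr⟩ := exists_locallyIntegrable_smoothTrace_eq_quotScalar Λ₀ hϖ hΛ μ hFC hZ c r hr hsc B hBsymm hBpos hBinv v₁ hv₁ Ω Fl M hlim hdom hM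
  obtain ⟨K, hK, hKs⟩ := exists_compact_mem_nhds s
  exact ⟨interior K, isOpen_interior, mem_interior_iff_mem_nhds.2 hKs, Θ, (hΘ.integrableOn_isCompact hK).mono_set interior_subset, fun f hf _ => htr f hf⟩

/-- **2A-1, ∃-packaged: «row 11 at `G_Λ` for a supercuspidal class ⟸ the NON-ELLIPTIC estimates for SOME datum»** — for `c` supercuspidal, if for SOME
representative `r`, SOME invariant positive-definite Hermitian `B`, SOME `v₁ ≠ 0`, SOME compact exhaustion `Ω` the truncated orbital integrals of `y ↦ B v₁ (r(y) v₁)`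
satisfy (lim∖ell) and (dom∖ell) with an `L¹_loc` majorant, then «charLocIntNear s» holds at every `s ∈ G_Λ`.  With §1 a brick proving the two estimates «for every
unitarizable supercuspidal datum along its own exhaustion» (the NE half 2N of road «GL₂-sc», K2E3-p23 (g6)) feeds this in one line. [cite: HarishChandra1970, Part VII Thm 16 p. 67, §3 pp. 70–73] -/
theorem charLocIntNear_quotScalar_of_exists_nonell {ϖ : F} (hϖ : Valued.v ϖ = WithZero.exp (-1 : ℤ)) (hΛ : IsClosed (Λ₀ : Set Fˣ))
    [NonarchimedeanGroup (GL (Fin 2) F ⧸ Λ₀.map (Matrix.GeneralLinearGroup.scalar (Fin 2)))]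
    (μ : Measure (GL (Fin 2) F ⧸ Λ₀.map (Matrix.GeneralLinearGroup.scalar (Fin 2)))) [μ.IsHaarMeasure] [μ.IsInvInvariant]
    (hFC : ∀ {C : Set (GL (Fin 2) F ⧸ Λ₀.map (Matrix.GeneralLinearGroup.scalar (Fin 2)))}, IsCompact C →
      ∀ {β : (GL (Fin 2) F ⧸ Λ₀.map (Matrix.GeneralLinearGroup.scalar (Fin 2))) → ℝ≥0∞}, IsCompact (tsupport β) →
      ∀ {Mb : ℝ≥0∞}, Mb ≠ ⊤ → (∀ g, β g ≤ Mb) →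
        ∫⁻ g in C ∩ {h : GL (Fin 2) F ⧸ Λ₀.map (Matrix.GeneralLinearGroup.scalar (Fin 2)) |
            IsCompact ((Subgroup.centralizer ({h} : Set (GL (Fin 2) F ⧸ Λ₀.map (Matrix.GeneralLinearGroup.scalar (Fin 2))))) :
              Set (GL (Fin 2) F ⧸ Λ₀.map (Matrix.GeneralLinearGroup.scalar (Fin 2))))},
          ∫⁻ x, β (x * g * x⁻¹) ∂μ ∂μ < ⊤)
    (hZ : IsCompact ((Subgroup.center (GL (Fin 2) F ⧸ Λ₀.map (Matrix.GeneralLinearGroup.scalar (Fin 2)))) :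
      Set (GL (Fin 2) F ⧸ Λ₀.map (Matrix.GeneralLinearGroup.scalar (Fin 2)))))
    (c : IrrClass (GL (Fin 2) F ⧸ Λ₀.map (Matrix.GeneralLinearGroup.scalar (Fin 2))))
    (hNE : ∃ r : SmoothIrrep (GL (Fin 2) F ⧸ Λ₀.map (Matrix.GeneralLinearGroup.scalar (Fin 2))), IrrClass.mk r = c ∧ r.ρ.IsSupercuspidal ∧
      ∃ B : r.V →ₗ⋆[ℂ] r.V →ₗ[ℂ] ℂ, B.IsSymm ∧ (∀ x : r.V, x ≠ 0 → 0 < (B x x).re) ∧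
        (∀ (g : GL (Fin 2) F ⧸ Λ₀.map (Matrix.GeneralLinearGroup.scalar (Fin 2))) (x y : r.V), B (r.ρ g x) (r.ρ g y) = B x y) ∧
        ∃ v₁ : r.V, v₁ ≠ 0 ∧
          ∃ (Ω : CompactExhaustion (GL (Fin 2) F ⧸ Λ₀.map (Matrix.GeneralLinearGroup.scalar (Fin 2))))
            (Fl : (GL (Fin 2) F ⧸ Λ₀.map (Matrix.GeneralLinearGroup.scalar (Fin 2))) → ℂ)
            (M : (GL (Fin 2) F ⧸ Λ₀.map (Matrix.GeneralLinearGroup.scalar (Fin 2))) → ℝ),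
            (∀ᵐ g ∂μ, ¬ IsCompact ((Subgroup.centralizer ({g} : Set (GL (Fin 2) F ⧸ Λ₀.map (Matrix.GeneralLinearGroup.scalar (Fin 2))))) :
                Set (GL (Fin 2) F ⧸ Λ₀.map (Matrix.GeneralLinearGroup.scalar (Fin 2)))) →
              Tendsto (fun n => ∫ x in Ω n, B v₁ (r.ρ (x * g * x⁻¹) v₁) ∂μ) atTop (𝓝 (Fl g))) ∧
            (∀ n, ∀ᵐ g ∂μ, ¬ IsCompact ((Subgroup.centralizer ({g} : Set (GL (Fin 2) F ⧸ Λ₀.map (Matrix.GeneralLinearGroup.scalar (Fin 2))))) :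
                Set (GL (Fin 2) F ⧸ Λ₀.map (Matrix.GeneralLinearGroup.scalar (Fin 2)))) →
              ‖∫ x in Ω n, B v₁ (r.ρ (x * g * x⁻¹) v₁) ∂μ‖ ≤ M g) ∧
            LocallyIntegrable M μ) :
    ∀ s : GL (Fin 2) F ⧸ Λ₀.map (Matrix.GeneralLinearGroup.scalar (Fin 2)),
      ∃ U : Set (GL (Fin 2) F ⧸ Λ₀.map (Matrix.GeneralLinearGroup.scalar (Fin 2))), IsOpen U ∧ s ∈ U ∧
        ∃ Θ : (GL (Fin 2) F ⧸ Λ₀.map (Matrix.GeneralLinearGroup.scalar (Fin 2))) → ℂ, IntegrableOn Θ U μ ∧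
          ∀ f : (GL (Fin 2) F ⧸ Λ₀.map (Matrix.GeneralLinearGroup.scalar (Fin 2))) → ℂ,
            f ∈ SchwartzBruhat (GL (Fin 2) F ⧸ Λ₀.map (Matrix.GeneralLinearGroup.scalar (Fin 2))) → tsupport f ⊆ U →
              c.smoothTrace μ f = ∫ g, f g * Θ g ∂μ := by
  obtain ⟨r, hr, hsc, B, hBsymm, hBpos, hBinv, v₁, hv₁, Ω, Fl, M, hlim, hdom, hM⟩ := hNE
  exact charLocIntNear_quotScalar_of_nonell Λ₀ hϖ hΛ μ hFC hZ c r hr hsc B hBsymm hBpos hBinv v₁ hv₁ Ω Fl M hlim hdom hM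


/-- **2A-1 WITH THE FRAME AND (FC) AT `G_Λ` DISCHARGED** (★ (2F-b″) `K2E3GL2ModCocompactFrame`: `G_Λ` is non-archimedean, has compact centre (`F` of characteristic `0`,
`F^× ⧸ Λ` compact) and every Haar measure on it is inversion invariant; ★ (2E-b2) `finConjModCocompact_cc`: (FC) at `G_Λ` from (FC) on `Ḡ`): for `Λ ≤ F^×` closed
cocompact, a Haar measure `μ` on `G_Λ = GL₂(F) ⧸ Λ·1`, Harish-Chandra's finiteness `hcc` on `Ḡ = GL₂(F) ⧸ Z` (★ (2E-b2)'s binder verbatim = the head of ★ (2E-b1) ∘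
(2E-a5): ∀ Borel structure and Haar measure `ν` on `Ḡ`) and a supercuspidal class `c` whose truncated orbital integrals satisfy the NON-ELLIPTIC estimates for EVERY
unitarizable supercuspidal datum (`hNE` = BRICK LIST v1.1 §1 `hNE₂` at this `μ`, the head of the NE half 2N), «charLocIntNear s» holds at every `s ∈ G_Λ`. [cite: HarishChandra1970, Part VII Thm 16 p. 67, §3 pp. 70–73]
[cite: Rogawski1990, §12.2 p. 173] -/
theorem charLocIntNear_quotScalar_of_finConjGL_cc_of_nonell [CharZero F] {ϖ : F} (hϖ : Valued.v ϖ = WithZero.exp (-1 : ℤ))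
    (hΛ : IsClosed (Λ₀ : Set Fˣ)) [CompactSpace (Fˣ ⧸ Λ₀)]
    (μ : Measure (GL (Fin 2) F ⧸ Λ₀.map (Matrix.GeneralLinearGroup.scalar (Fin 2)))) [μ.IsHaarMeasure]
    (hcc : ∀ [MeasurableSpace (GL (Fin 2) F ⧸ Subgroup.center (GL (Fin 2) F))] [BorelSpace (GL (Fin 2) F ⧸ Subgroup.center (GL (Fin 2) F))]
      (ν : Measure (GL (Fin 2) F ⧸ Subgroup.center (GL (Fin 2) F))) [ν.IsHaarMeasure]
      {C : Set (GL (Fin 2) F ⧸ Subgroup.center (GL (Fin 2) F))}, IsCompact C →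
      ∀ {β : (GL (Fin 2) F ⧸ Subgroup.center (GL (Fin 2) F)) → ℝ≥0∞}, Continuous β → IsCompact (tsupport β) →
      ∀ {Mb : ℝ≥0∞}, Mb ≠ ⊤ → (∀ g, β g ≤ Mb) →
      ∫⁻ g in C ∩ {h : GL (Fin 2) F ⧸ Subgroup.center (GL (Fin 2) F) | IsCompact ((Subgroup.centralizer ({h} : Set (GL (Fin 2) F ⧸ Subgroup.center (GL (Fin 2) F)))) :
          Set (GL (Fin 2) F ⧸ Subgroup.center (GL (Fin 2) F)))}, ∫⁻ x, β (x * g * x⁻¹) ∂ν ∂ν < ⊤)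
    (c : IrrClass (GL (Fin 2) F ⧸ Λ₀.map (Matrix.GeneralLinearGroup.scalar (Fin 2)))) (hc : c.IsSupercuspidal)
    (hNE : ∀ (r : SmoothIrrep (GL (Fin 2) F ⧸ Λ₀.map (Matrix.GeneralLinearGroup.scalar (Fin 2)))), r.ρ.IsSupercuspidal →
      ∀ (B : r.V →ₗ⋆[ℂ] r.V →ₗ[ℂ] ℂ), (∀ (g : GL (Fin 2) F ⧸ Λ₀.map (Matrix.GeneralLinearGroup.scalar (Fin 2))) (x y : r.V), B (r.ρ g x) (r.ρ g y) = B x y) →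
      ∀ (v₁ : r.V),
        ∃ (Ω : CompactExhaustion (GL (Fin 2) F ⧸ Λ₀.map (Matrix.GeneralLinearGroup.scalar (Fin 2))))
          (Fl : (GL (Fin 2) F ⧸ Λ₀.map (Matrix.GeneralLinearGroup.scalar (Fin 2))) → ℂ)
          (M : (GL (Fin 2) F ⧸ Λ₀.map (Matrix.GeneralLinearGroup.scalar (Fin 2))) → ℝ),
          (∀ᵐ g ∂μ, ¬ IsCompact ((Subgroup.centralizer ({g} : Set (GL (Fin 2) F ⧸ Λ₀.map (Matrix.GeneralLinearGroup.scalar (Fin 2))))) :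
              Set (GL (Fin 2) F ⧸ Λ₀.map (Matrix.GeneralLinearGroup.scalar (Fin 2)))) →
            Tendsto (fun n => ∫ x in Ω n, B v₁ (r.ρ (x * g * x⁻¹) v₁) ∂μ) atTop (𝓝 (Fl g))) ∧
          (∀ n, ∀ᵐ g ∂μ, ¬ IsCompact ((Subgroup.centralizer ({g} : Set (GL (Fin 2) F ⧸ Λ₀.map (Matrix.GeneralLinearGroup.scalar (Fin 2))))) :
              Set (GL (Fin 2) F ⧸ Λ₀.map (Matrix.GeneralLinearGroup.scalar (Fin 2)))) →
            ‖∫ x in Ω n, B v₁ (r.ρ (x * g * x⁻¹) v₁) ∂μ‖ ≤ M g) ∧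
          LocallyIntegrable M μ) :
    ∀ s : GL (Fin 2) F ⧸ Λ₀.map (Matrix.GeneralLinearGroup.scalar (Fin 2)),
      ∃ U : Set (GL (Fin 2) F ⧸ Λ₀.map (Matrix.GeneralLinearGroup.scalar (Fin 2))), IsOpen U ∧ s ∈ U ∧
        ∃ Θ : (GL (Fin 2) F ⧸ Λ₀.map (Matrix.GeneralLinearGroup.scalar (Fin 2))) → ℂ, IntegrableOn Θ U μ ∧
          ∀ f : (GL (Fin 2) F ⧸ Λ₀.map (Matrix.GeneralLinearGroup.scalar (Fin 2))) → ℂ,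
            f ∈ SchwartzBruhat (GL (Fin 2) F ⧸ Λ₀.map (Matrix.GeneralLinearGroup.scalar (Fin 2))) → tsupport f ⊆ U →
              c.smoothTrace μ f = ∫ g, f g * Θ g ∂μ := by
  haveI : NonarchimedeanGroup (GL (Fin 2) F ⧸ Λ₀.map (Matrix.GeneralLinearGroup.scalar (Fin 2))) := nonarchimedeanGroup_quotScalar Λ₀
  haveI : μ.IsInvInvariant := isInvInvariant_quotScalar_of_isHaarMeasure Λ₀ hΛ hϖ μ
  have hZ : IsCompact ((Subgroup.center (GL (Fin 2) F ⧸ Λ₀.map (Matrix.GeneralLinearGroup.scalar (Fin 2)))) :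
      Set (GL (Fin 2) F ⧸ Λ₀.map (Matrix.GeneralLinearGroup.scalar (Fin 2)))) := isCompact_center_quotScalar Λ₀
  obtain ⟨r, hr, hsc, -, B, hBsymm, hBpos, hBinv⟩ := exists_rep_data_of_isSupercuspidal_quotScalar Λ₀ hZ c hc
  haveI : r.ρ.IsIrreducible := r.isIrreducible
  haveI : Nontrivial r.V := Representation.IsIrreducible.nontrivial r.ρ
  obtain ⟨v₁, hv₁⟩ := exists_ne (0 : r.V)
  obtain ⟨Ω, Fl, M, hlim, hdom, hM⟩ := hNE r hsc B hBinv v₁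
  exact charLocIntNear_quotScalar_of_nonell Λ₀ hϖ hΛ μ (fun hC _ hβs _ hMb hβM => finConjModCocompact_cc hcc Λ₀ μ hC hβs hMb hβM) hZ c r hr hsc B hBsymm
    hBpos hBinv v₁ hv₁ Ω Fl M hlim hdom hM


/-! ## §4 (ED. 2) Everything but the non-elliptic estimates discharged: (FC) on `Ḡ` is ★ (2E-a5) -/

/-- **2A-1, UNCONDITIONAL IN (FC)** (ED. 2, after ★ (2E-a5) p858976 `K2E3GL2FinConj.finConjGL_cc` — Harish-Chandra's finiteness of the conjugation-fibre integral on
`Ḡ = GL₂(F) ⧸ Z`, compact-centraliser domain, for every Borel structure and Haar measure): for `Λ ≤ F^×` closed cocompact, a Haar measure `μ` on `G_Λ = GL₂(F) ⧸ Λ·1` and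
a supercuspidal class `c` of `G_Λ`, IF the truncated orbital integrals of the coefficients satisfy the NON-ELLIPTIC estimates for every unitarizable supercuspidal datum
(`hNE` = BRICK LIST v1.1 §1 `hNE₂` at this `μ`; the NE half 2N of road «GL₂-sc», K2E3-p23 (g6)), THEN «charLocIntNear s» holds at every `s ∈ G_Λ` — §3 with
`hcc := fun ν _ => K2E3GL2FinConj.finConjGL_cc hϖ ν`.  At `Λ₀ := ϖ^ℤ` this is (HC16₂) of ★ (2A-2) `K2E3GL2SupercuspidalCharLocInt` modulo `hNE₂` only.
[cite: HarishChandra1970, Part VII Thm 16 p. 67, §2 p. 69, §3 pp. 70–73] [cite: Rogawski1990, §12.2 p. 173] -/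
theorem charLocIntNear_quotScalar_of_nonell_estimates [CharZero F] {ϖ : F} (hϖ : Valued.v ϖ = WithZero.exp (-1 : ℤ))
    (hΛ : IsClosed (Λ₀ : Set Fˣ)) [CompactSpace (Fˣ ⧸ Λ₀)]
    (μ : Measure (GL (Fin 2) F ⧸ Λ₀.map (Matrix.GeneralLinearGroup.scalar (Fin 2)))) [μ.IsHaarMeasure]
    (c : IrrClass (GL (Fin 2) F ⧸ Λ₀.map (Matrix.GeneralLinearGroup.scalar (Fin 2)))) (hc : c.IsSupercuspidal)
    (hNE : ∀ (r : SmoothIrrep (GL (Fin 2) F ⧸ Λ₀.map (Matrix.GeneralLinearGroup.scalar (Fin 2)))), r.ρ.IsSupercuspidal →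
      ∀ (B : r.V →ₗ⋆[ℂ] r.V →ₗ[ℂ] ℂ), (∀ (g : GL (Fin 2) F ⧸ Λ₀.map (Matrix.GeneralLinearGroup.scalar (Fin 2))) (x y : r.V), B (r.ρ g x) (r.ρ g y) = B x y) →
      ∀ (v₁ : r.V),
        ∃ (Ω : CompactExhaustion (GL (Fin 2) F ⧸ Λ₀.map (Matrix.GeneralLinearGroup.scalar (Fin 2))))
          (Fl : (GL (Fin 2) F ⧸ Λ₀.map (Matrix.GeneralLinearGroup.scalar (Fin 2))) → ℂ)
          (M : (GL (Fin 2) F ⧸ Λ₀.map (Matrix.GeneralLinearGroup.scalar (Fin 2))) → ℝ),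
          (∀ᵐ g ∂μ, ¬ IsCompact ((Subgroup.centralizer ({g} : Set (GL (Fin 2) F ⧸ Λ₀.map (Matrix.GeneralLinearGroup.scalar (Fin 2))))) :
              Set (GL (Fin 2) F ⧸ Λ₀.map (Matrix.GeneralLinearGroup.scalar (Fin 2)))) →
            Tendsto (fun n => ∫ x in Ω n, B v₁ (r.ρ (x * g * x⁻¹) v₁) ∂μ) atTop (𝓝 (Fl g))) ∧
          (∀ n, ∀ᵐ g ∂μ, ¬ IsCompact ((Subgroup.centralizer ({g} : Set (GL (Fin 2) F ⧸ Λ₀.map (Matrix.GeneralLinearGroup.scalar (Fin 2))))) :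
              Set (GL (Fin 2) F ⧸ Λ₀.map (Matrix.GeneralLinearGroup.scalar (Fin 2)))) →
            ‖∫ x in Ω n, B v₁ (r.ρ (x * g * x⁻¹) v₁) ∂μ‖ ≤ M g) ∧
          LocallyIntegrable M μ) :
    ∀ s : GL (Fin 2) F ⧸ Λ₀.map (Matrix.GeneralLinearGroup.scalar (Fin 2)),
      ∃ U : Set (GL (Fin 2) F ⧸ Λ₀.map (Matrix.GeneralLinearGroup.scalar (Fin 2))), IsOpen U ∧ s ∈ U ∧
        ∃ Θ : (GL (Fin 2) F ⧸ Λ₀.map (Matrix.GeneralLinearGroup.scalar (Fin 2))) → ℂ, IntegrableOn Θ U μ ∧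
          ∀ f : (GL (Fin 2) F ⧸ Λ₀.map (Matrix.GeneralLinearGroup.scalar (Fin 2))) → ℂ,
            f ∈ SchwartzBruhat (GL (Fin 2) F ⧸ Λ₀.map (Matrix.GeneralLinearGroup.scalar (Fin 2))) → tsupport f ⊆ U →
              c.smoothTrace μ f = ∫ g, f g * Θ g ∂μ :=
  charLocIntNear_quotScalar_of_finConjGL_cc_of_nonell Λ₀ hϖ hΛ μ (fun ν _ => K2E3GL2FinConj.finConjGL_cc hϖ ν) c hc hNE

end Summit.HodgeConjecture.HodgeConjecture.Cruxes.H413.K2E3GL2ModCocompactCharLocInt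

end
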